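import Summits.BirchSwinnertonDyer.BirchSwinnertonDyer.Theorems.SlopeDichotomyA2DegenerateLocusA2RegulatorFloorPub
import Summits.BirchSwinnertonDyer.Rank1Residual.X1.AnomalousPointCount
import Literature.NumberTheory.EllipticCurves.CanonicalPAdicHeightIntegralityAnomalousProofs
import HarnessLib

/-!
# Corner A2 with `p ∤` the local Tamagawa indices: the Mazur–Tate floor `ord_p Reg_p ≥ −1` is UNCONDITIONAL,
# so `λ_an = 1` would pin `ord_p Reg_p = −1`, `p ∤ ∏c_ℓ`, `p ∤ #Ш[p^∞]` exactly

Support file (prover seat `bsd-schneider-i1-c2`, gen 5; `--supports stmt-BirchSwinnertonDyer-19086`), third of the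
regulator-floor series (`…RegulatorFloor.lean` p448248, `…RegulatorFloorPub.lean` p448618). It consumes the
Literature theorem `WeierstrassCurve.valuation_padicRegulator_ge_of_not_dvd_index`
(`CanonicalPAdicHeightIntegralityAnomalousProofs.lean`, p449039: Mazur–Tate 1983 §3.3 value subgroup WITH the
anomalous term `n_p`, PROVED — `Reg_p ≠ 0 ⇒ (1 − 2·ord_p #Ẽ(𝔽_p))·rank ≤ ord_p Reg_p` at a good `p ≥ 3` with
`p ∤ [E(ℚ) : E(ℚ) ∩ E⁰(ℚ_ℓ)]` for all `ℓ`) on corner A2, where `ord_p #Ẽ(𝔽_p) = 1`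
(`RankOne.Leaf.padicValNat_reductionPointCount_eq_one`) and `rank = 1` (GZK):

* §1 **`neg_one_le_valuation_padicRegulator_of_typeBRankOne`** — on A2 with `p ∤` the local indices, THE
  canonical regulator has `ord_p Reg_p ≥ −1` whenever it is non-zero (the floor `v = −1` of x1b's valued
  certificate `hReg : Reg_p ≠ 0 ∧ v ≤ ord_p Reg_p` is AUTOMATIC there; observed `= −1` on 39 of the 2 797
  census pairs, all with `p² ∣ c_ℓ`, memo ROUTE-P3-v8 §1.3).
* §2 **`lamOne_profile_of_typeBRankOne`** — hence (with `…RegulatorFloorPub`'s pole `ord Reg + ord Tam +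
  ord Ш[p^∞] ≤ −1`, published inputs only) `λ_an = 1` on that part of A2 would force EXACTLY
  `ord_p Reg_p = −1 ∧ p ∤ ∏c_ℓ ∧ p ∤ #Ш(E)[p^∞]`: the unit-coefficient road's habitat on A2 is pinned to
  one valuation profile. (Memo H-int says `ord_p Reg_p ≥ 0` on the unramified member when `p ∤ ∏c_ℓ` — the
  isogeny-descent unit the crude floor lacks; typing it kills the profile and yields T-λ3 class-wide there.)
* §3 **`mazurMainConjecture_and_bsdp_of_typeBRankOne_of_lamThree_of_schneider_of_dvd_tamagawa`** — x1b's
  P₃ road on A2 with BOTH valued inputs discharged: `p ∤` local indices, `p ∣ ∏c_ℓ`, `λ_an = 3` and the bare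
  Schneider certificate `Reg_p ≠ 0` give Mazur's MC ∧ BSD(E,p) (`v = −1` from §1, `hb` from `p ∣ ∏c_ℓ`,
  `μ_an = 0` from GV + Greenberg 5.10, `htors` from type B).

THEOREMS ONLY; inputs by name (W16, BMS 1.7, PR87, GV 1.3, Greenberg 3.10/5.10, Mazur–Tate σ, modularity,
GZK); nothing booked. Relation to item 19086: unchanged (DECIDED-REDUCED); these are constraints on the
COMPLEMENT `{λ_an = 1}` of the locus `{λ_an ≥ 3} ⊇ {Reg_p = 0}` where 19086 has content.

References: [MazurTate1983Biext] §3.3, (4.1.1); [MazurSteinTate2006] §4 p. 19; [BalakrishnanMullerStein2015]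
Thm. 1.7; [GreenbergVatsal2000] Thm. (1.3); [GreenbergLNM1716] Prop. 3.10, Prop. 5.10, §5 p. 183;
[Wuthrich2014] Thm. 16; cell memo ROUTE-P3-v8-lambda-g10 §1.3–1.4.
-/

set_option autoImplicit false

noncomputable section

open scoped Classical MatrixGroups ModularForm

open PowerSeries CongruenceSubgroup WeierstrassCurve Literature.NumberTheory.EllipticCurves
  Literature.NumberTheory.EllipticCurves.ModularForms
  Literature.NumberTheory.EllipticCurves.Rank1Residual
  Literature.NumberTheory.EllipticCurves.Greenberg1999
  Summit.BirchSwinnertonDyer.Rank1Residual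
  Summit.BirchSwinnertonDyer.BirchSwinnertonDyer.Theorems.Rank1ResidualX1Defs
  Summit.BirchSwinnertonDyer.Rank1Residual.X1.MuLambda
  Summit.BirchSwinnertonDyer.Rank1Residual.X1.MuPart
  Summit.BirchSwinnertonDyer.Rank1Residual.X1.ParitySqueeze
  Summit.BirchSwinnertonDyer.BirchSwinnertonDyer.Theses
  Summit.BirchSwinnertonDyer.BirchSwinnertonDyer.Theorems

-- `Summit.BirchSwinnertonDyer.BirchSwinnertonDyer.…`: the summit and its single sub-problem share a name (D-0017 layout).
set_option linter.dupNamespace false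

namespace Summit.BirchSwinnertonDyer.BirchSwinnertonDyer.Theorems.DegenerateLocusA2RegulatorFloorSharp

variable {W : WeierstrassCurve ℚ} [W.IsElliptic] [W.IsGloballyMinimal] {p : ℕ} [Fact p.Prime]

/-! ## §1. The Mazur–Tate floor `ord_p Reg_p ≥ −1` on corner A2 (unconditional given `p ∤` local indices + GZK) -/

/-- **On corner A2, `ord_p Reg_p ≥ −1` for THE canonical regulator** whenever it is non-zero, provided
`p ∤ [E(ℚ) : E(ℚ) ∩ E⁰(ℚ_ℓ)]` for every prime `ℓ` (e.g. `p ∤ c_ℓ` for all `ℓ`): Mazur–Tate 1983 §3.3 with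
the anomalous term (`valuation_padicRegulator_ge_of_not_dvd_index`, PROVED), `ord_p #Ẽ(𝔽_p) = 1` on the leaf,
`rank = 1` by GZK (`hGZK`). [cite: MazurTate1983Biext, §3.3 (display after (3.3.4)) and (4.1.1)]
[cite: MazurSteinTate2006, §4 p. 19] -/
theorem neg_one_le_valuation_padicRegulator_of_typeBRankOne
    (hGZK : rank_eq_analyticRank_of_analyticRank_le_one) (hB : X1.TypeBRankOne W p)
    (hidx : ∀ (ℓ : ℕ) [Fact ℓ.Prime], ¬ p ∣ (W.nonsingularReductionSubgroupAt ℓ).index)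
    {Dh : PAdicHeightData W p} (hDh : Dh.IsCanonical) (hR : padicRegulator Dh ≠ 0) :
    -1 ≤ (padicRegulator Dh).valuation := by
  have hX := isClassX1_of_classX1 hB.1
  have hL : X1.RankOne.Leaf W p := X1.RankOne.leaf_of_classX1 hB.1 hB.2.1
  have hp3 : 3 ≤ p := by
    have h2 := hB.1.1
    have hp2 := hX.two_ne
    omega
  have h := valuation_padicRegulator_ge_of_not_dvd_index W p hp3 hX.hasGoodReductionAtPrime hidx hDh hR
  have hN : (padicValNat p (W.reductionPointCount p) : ℤ) = 1 := by
    exact_mod_cast hL.padicValNat_reductionPointCount_eq_one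
  obtain ⟨hrk, -⟩ := hGZK W hB.2.1.le
  have hr1 : (W.mordellWeilRank : ℤ) = 1 := by exact_mod_cast hrk.trans hB.2.1
  rw [hN, hr1] at h
  linarith

/-! ## §2. The exact valuation profile `λ_an = 1` would force on corner A2 -/

/-- **If the unit-coefficient road fired on corner A2 (with `p ∤` the local indices), the pair would have
EXACTLY `ord_p Reg_p = −1`, `p ∤ ∏c_ℓ` and `p ∤ #Ш(E)[p^∞]`** — published inputs only (W16, BMS 1.7, GV 1.3,
Greenberg 5.10, modularity, GZK) plus the certificate `λ_an = 1` itself: the pole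
`ord Reg + ord Tam + ord Ш[p^∞] ≤ −1` of `…RegulatorFloorPub`/`…RegulatorFloor` §2 meets the floor
`ord Reg ≥ −1` of §1. [cite: BalakrishnanMullerStein2015, Thm. 1.7] [cite: MazurTate1983Biext, §3.3]
[cite: GreenbergVatsal2000, Thm. (1.3)] [cite: GreenbergLNM1716, Prop. 5.10 (PDF p. 147)] -/
theorem lamOne_profile_of_typeBRankOne
    (hW16 : Wuthrich2014.charIdeal_dvd_padicLFunction) (hS : Schneider1985_order_charGenerator_odd)
    (hGV : GreenbergVatsal2000.thm13_charIdeal_eq_of_gvPar)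
    (h510 : prop510_isTorsion_hasUnitContent_of_gvPar)
    (hmodP : nonempty_modularParametrizationData) (hGZK : rank_eq_analyticRank_of_analyticRank_le_one)
    (hB : X1.TypeBRankOne W p)
    (hidx : ∀ (ℓ : ℕ) [Fact ℓ.Prime], ¬ p ∣ (W.nonsingularReductionSubgroupAt ℓ).index)
    (hlam1 : AnalyticLambdaEq W p 1) {Dh : PAdicHeightData W p} (hDh : Dh.IsCanonical) :
    padicRegulator Dh ≠ 0 ∧ (padicRegulator Dh).valuation = -1 ∧
      padicValNat p W.tamagawaProduct = 0 ∧
      padicValNat p (Nat.card (AddCommGroup.primaryComponent W.sha p)) = 0 := by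
  obtain ⟨hR, hle⟩ :=
    DegenerateLocusA2RegulatorFloor.valuation_padicRegulator_add_le_of_typeBRankOne_of_analyticLambdaEq_one
      hW16 hS hmodP hGZK hB (DegenerateLocusA2RegulatorFloorPub.analyticMuLE_zero_of_typeBRankOne hGV h510 hB)
      hlam1 hDh
  have hfloor := neg_one_le_valuation_padicRegulator_of_typeBRankOne hGZK hB hidx hDh hR
  have hT : (0 : ℤ) ≤ padicValNat p W.tamagawaProduct := by exact_mod_cast Nat.zero_le _
  have hSh : (0 : ℤ) ≤ padicValNat p (Nat.card (AddCommGroup.primaryComponent W.sha p)) := by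
    exact_mod_cast Nat.zero_le _
  simp only [Nat.cast_zero, zero_sub] at hle
  refine ⟨hR, by linarith, ?_, ?_⟩
  · have : (padicValNat p W.tamagawaProduct : ℤ) ≤ 0 := by linarith
    exact_mod_cast le_antisymm (by exact_mod_cast this) (Nat.zero_le _)
  · have : (padicValNat p (Nat.card (AddCommGroup.primaryComponent W.sha p)) : ℤ) ≤ 0 := by linarith
    exact_mod_cast le_antisymm (by exact_mod_cast this) (Nat.zero_le _)

/-- **Corollary: on corner A2 with `p ∤` the local indices and `p ∣ ∏c_ℓ`, `λ_an ≠ 1`** — published inputs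
only, NO height datum inspected (the profile of `lamOne_profile_of_typeBRankOne` requires `p ∤ ∏c_ℓ`).
[cite: BalakrishnanMullerStein2015, Thm. 1.7] [cite: MazurTate1983Biext, §3.3] [cite: GreenbergVatsal2000, Thm. (1.3)] -/
theorem not_analyticLambdaEq_one_of_typeBRankOne_of_dvd_tamagawa
    (hW16 : Wuthrich2014.charIdeal_dvd_padicLFunction) (hS : Schneider1985_order_charGenerator_odd)
    (hGV : GreenbergVatsal2000.thm13_charIdeal_eq_of_gvPar)
    (h510 : prop510_isTorsion_hasUnitContent_of_gvPar) (hMT : mazur_tate_sigma_exists_odd)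
    (hmodP : nonempty_modularParametrizationData) (hGZK : rank_eq_analyticRank_of_analyticRank_le_one)
    (hB : X1.TypeBRankOne W p)
    (hidx : ∀ (ℓ : ℕ) [Fact ℓ.Prime], ¬ p ∣ (W.nonsingularReductionSubgroupAt ℓ).index)
    (hTam : p ∣ W.tamagawaProduct) : ¬ AnalyticLambdaEq W p 1 := by
  intro hlam1
  have hX := isClassX1_of_classX1 hB.1
  obtain ⟨Dh, hDh, -⟩ := existsUnique_isCanonical_of_odd hMT W p hX.two_ne hX.hasGoodReductionAtPrime
    hX.not_dvd_frobeniusTrace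
  obtain ⟨-, -, hT0, -⟩ := lamOne_profile_of_typeBRankOne hW16 hS hGV h510 hmodP hGZK hB hidx hlam1 hDh
  have hpos : 0 < W.tamagawaProduct := W.tamagawaProduct_pos_holds
  have h1 : 1 ≤ padicValNat p W.tamagawaProduct :=
    one_le_padicValNat_of_dvd hpos.ne' hTam
  omega

/-! ## §3. x1b's P₃ road on corner A2 with both valued inputs discharged on `{p ∤ indices, p ∣ ∏c_ℓ}` -/

/-- **P₃ on corner A2 from the BARE Schneider certificate** (sub-population `p ∤` local indices, `p ∣ ∏c_ℓ`):
`λ_an = 3` and `Reg_p ≠ 0` for every canonical datum ⇒ Mazur's MC ∧ BSD(E,p) — x1b's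
`RankOne.Leaf.mazurMainConjecture_and_bsdp_of_lamThree` with `μ_an = 0` from GV Thm 1.3 + Greenberg 5.10,
the μ-part from W16, `htors` from type B (`…RegulatorFloor.not_dvd_torsionOrder_of_typeBRankOne`), the
valued half `v = −1` from §1 and `hb : 0 + 0 + 1 < −1 + ord ∏c_ℓ + 2` from `p ∣ ∏c_ℓ`. Granted W16,
Perrin-Riou–Schneider, PR87, Mazur–Tate σ, modularity, GZK, Greenberg 3.10/5.10, GV 1.3 by name.
[cite: GreenbergLNM1716, Prop. 3.10 and §5 p. 183] [cite: Wuthrich2014, Thm. 16 (p. 393)]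
[cite: BalakrishnanMullerStein2015, Thm. 1.7] [cite: MazurTate1983Biext, §3.3] -/
theorem mazurMainConjecture_and_bsdp_of_typeBRankOne_of_lamThree_of_schneider_of_dvd_tamagawa
    (hW16 : Wuthrich2014.charIdeal_dvd_padicLFunction) (hS : Schneider1985_order_charGenerator_odd)
    (hPR : perrinRiou_rankOne_leadingTerms_odd) (hMT : mazur_tate_sigma_exists_odd)
    (hmodP : nonempty_modularParametrizationData) (hGZK : rank_eq_analyticRank_of_analyticRank_le_one)
    (h310 : prop310_selmerCorank_mod_two_eq_lambdaInvariant)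
    (hGV : GreenbergVatsal2000.thm13_charIdeal_eq_of_gvPar)
    (h510 : prop510_isTorsion_hasUnitContent_of_gvPar) (hB : X1.TypeBRankOne W p)
    (hidx : ∀ (ℓ : ℕ) [Fact ℓ.Prime], ¬ p ∣ (W.nonsingularReductionSubgroupAt ℓ).index)
    (hTam : p ∣ W.tamagawaProduct) (hlam3 : AnalyticLambdaEq W p 3)
    (hSch : ∀ Dh : PAdicHeightData W p, Dh.IsCanonical → padicRegulator Dh ≠ 0) :
    MazurMainConjecture W p ∧ BSDp W p := by
  have hX := isClassX1_of_classX1 hB.1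
  have hL : X1.RankOne.Leaf W p := X1.RankOne.leaf_of_classX1 hB.1 hB.2.1
  have hμ0 : AnalyticMuLE W p 0 :=
    DegenerateLocusA2RegulatorFloorPub.analyticMuLE_zero_of_typeBRankOne hGV h510 hB
  have hμ : MuPartAt W p := muPartAt_of_analyticMuLE_zero hW16 hX.two_ne hX.hasGoodReductionAtPrime
    hX.not_dvd_frobeniusTrace hX.not_hasIrreducibleModPGaloisRep hμ0
  refine hL.mazurMainConjecture_and_bsdp_of_lamThree hW16 hS hPR hMT hmodP hGZK h310 hμ0 hμ hlam3
    (v := -1) (fun Dh hDh ↦ ⟨hSch Dh hDh,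
      neg_one_le_valuation_padicRegulator_of_typeBRankOne hGZK hB hidx hDh (hSch Dh hDh)⟩) ?_
  have ht : (padicValNat p W.torsionOrder : ℤ) = 0 := by
    exact_mod_cast padicValNat.eq_zero_of_not_dvd
      (DegenerateLocusA2RegulatorFloor.not_dvd_torsionOrder_of_typeBRankOne W p hB)
  have hN : (padicValNat p (W.reductionPointCount p) : ℤ) = 1 := by
    exact_mod_cast hL.padicValNat_reductionPointCount_eq_one
  have hpos : 0 < W.tamagawaProduct := W.tamagawaProduct_pos_holds
  have h1 : (1 : ℤ) ≤ padicValNat p W.tamagawaProduct := by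
    exact_mod_cast one_le_padicValNat_of_dvd hpos.ne' hTam
  rw [ht, hN]
  push_cast at h1 ⊢
  linarith

end Summit.BirchSwinnertonDyer.BirchSwinnertonDyer.Theorems.DegenerateLocusA2RegulatorFloorSharp

end
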